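import Summits.AtomisticToContinuum.BoseEinsteinCondensation.Theorems.BECConjugateDominationPuffFloorSolidCore
import Summits.AtomisticToContinuum.BoseEinsteinCondensation.Theorems.BECConjugateDominationPuffFloorPairMomentOfPairCount
import Summits.AtomisticToContinuum.BoseEinsteinCondensation.Theorems.BECConjugateDominationPuffFloorPairCountDomination
import Summits.AtomisticToContinuum.BoseEinsteinCondensation.Theorems.BECConjugateDominationPuffFloorRemovalEnergy
import Summits.AtomisticToContinuum.BoseEinsteinCondensation.Theorems.BECConjugateDominationPuffFloorInnerPairCount

/-!
# Route `BECConjugateDomination`, crux `PuffFloor` (stmt-AtomisticToContinuum-11785): CLOSED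

Closes stmt-AtomisticToContinuum-11785 (`Theses.BECConjugateDomination.PuffFloor`) — the linear anti-hyperuniformity
floor `S_m ≥ |k|/√(|k|² + Cρ)` for the positive exact minimiser of every smooth-class potential, eventually in `N` at
every small density — along the line `coupling-slope-pocket` (registered skeleton v6,
`Cruxes/PuffFloor/Lines/coupling_slope_pocket.lean`).

* Solid core `0 < v 0`: `stub_puffFloorSolidCore` (p93248; S1 pocket classical stability, S2 Lee's no-binding theorem, S3
  Born, S4a Euler–Lagrange, S4b Puff–Feynman engine, S5/S6 positive minimiser and its uniqueness).
* Coreless `v 0 = 0`, `v ≢ 0` on `(0,∞)`: the close-pair COUNT at the range scale is `O(ρN)` for the exact minimiser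
  (`corelessPairCount`): OUTER count by Lee's cell/torus machinery on the cored comparison potential
  `v + 1_{≤ r_in}` (`stub_pairCountDomination`), INNER count by the maximum principle for the smeared pair density of
  the minimiser, a weak subsolution of `Δ + μ₂` (`stub_innerPairCount` over `stub_weakPairSubsolution`,
  `stub_smearedPairDensityLaplacian`, `stub_maxPrinciple`), removal energy `μ₂ = O(ρ)` (`stub_removalEnergy`), Born;
  then c1's reduction count ⇒ Puff pair moment (`stub_pairMomentOfPairCount`, p98185) and the Puff–Feynman engine.
* `v ≡ 0` on `[0,∞)`: the Puff weight vanishes identically.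

References: Puff1965; Feynman1954; Stringari1995 §2.3 (20)–(23); Lee2009 (J. Stat. Phys. 134) Thm 7; LSSY2005 Ch. 2;
Protter–Weinberger 1967 Ch. 2.
-/

noncomputable section

namespace Summit.AtomisticToContinuum.BoseEinsteinCondensation.Theorems

open MeasureTheory Filter
open scoped ENNReal NNReal BigOperators
open Literature.MathematicalPhysics.QuantumManyBody.BoseGas
open Summit.AtomisticToContinuum.BoseEinsteinCondensation.Theses.BECConjugateDomination
open Summit.AtomisticToContinuum.BoseEinsteinCondensation.Theorems.PuffFloorSolidCore

namespace PuffFloorAssembly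

/-! ## The composition -/

/-- **S7′ `corelessPairCount` (THEOREM modulo S7out, S7in, S7b; c1's reshaped residual = the planner's
`PairCountBound`).** For a smooth-class coreless `v` (`v 0 = 0`, not identically zero on `(0,∞)`) with range
parameter `R₀`, the expected number of pairs at torus distance `≤ R₀` in the positive `C³` exact minimiser is
`≤ C_N ρ (n+1)`, eventually in `n`, for `ρ < ρ₁`. Composition: `L = L_{n+1}(ρ) → ∞` passes `L₀` (S7out) and `L₁`
(S7in); S7b with `L³ = (n+1)/ρ` gives `E₀(n+1) − E₀(n−1) ≤ 2ρ‖ṽ‖₁ ≤ λ₁` for `ρ < ρ₁ = λ₁/(2‖ṽ‖₁+1)`;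
count(R₀) ≤ K(E₀ + C_in E₀) and Born `E₀ ≤ ‖ṽ‖₁ρ(n+1)` (`bornEnergyBound`). -/
theorem corelessPairCount :
    ∀ v : ℝ → ℝ≥0∞, IsRepulsiveFiniteRange v → (∀ r, v r ≠ ⊤) →
      ContDiff ℝ 2 (fun x : Space => (v ‖x‖).toReal) →
      (∃ Cₑ : ℝ, ∀ x : Space, ‖iteratedFDeriv ℝ 2 (fun x : Space => (v ‖x‖).toReal) x‖
          ≤ Cₑ * Real.sqrt ((v ‖x‖).toReal)) →
      v 0 = 0 → (∃ r, 0 < r ∧ 0 < v r) → ∀ R₀ : ℝ, 0 < R₀ → (∀ r, R₀ < r → v r = 0) →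
      ∃ C_N : ℝ, 0 ≤ C_N ∧ ∃ ρ₁ : ℝ, 0 < ρ₁ ∧ ∀ ρ : ℝ, 0 < ρ → ρ < ρ₁ → ∀ᶠ n : ℕ in atTop,
        ∀ Ψ : PeriodicTrialState (n + 1) (sideLength ρ (n + 1)), ContDiff ℝ 3 Ψ.ψ →
          periodicEnergy v Ψ = periodicGroundStateEnergy v (n + 1) (sideLength ρ (n + 1)) →
          periodicEnergy v Ψ ≠ ⊤ → (∀ X, Ψ.ψ X = (‖Ψ.ψ X‖ : ℂ)) → (∀ X, Ψ.ψ X ≠ 0) →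
          (∫⁻ X in cellN (n + 1) (sideLength ρ (n + 1)),
              periodicInteraction (Set.indicator (Set.Iic R₀) (fun _ : ℝ => (1 : ℝ≥0∞)))
                (sideLength ρ (n + 1)) X * (‖Ψ.ψ X‖₊ : ℝ≥0∞) ^ 2)
            ≤ ENNReal.ofReal (C_N * ρ * ((n : ℝ) + 1)) := by
  intro v hv hfin hC2 _hedge h0 hpos R₀ hR₀ _hrange
  obtain ⟨rin, Cin, L₁, lam₁, hrin, hCin, hL₁, hlam₁, hin⟩ := stub_innerPairCount v hv hfin hC2 h0 hpos
  obtain ⟨K, L₀, hK, hL₀, hout⟩ := stub_pairCountDomination v hv.1 rin R₀ hrin hR₀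
  obtain ⟨CE, hCE0, hCE⟩ := bornEnergyBound v hv hfin hC2
  have hItop : (∫⁻ x : Space, v ‖x‖) ≠ ⊤ := (lintegral_lt_top_of_smooth hv hfin hC2).ne
  set V₁ : ℝ := (∫⁻ x : Space, v ‖x‖).toReal with hV₁
  have hV₁0 : 0 ≤ V₁ := ENNReal.toReal_nonneg
  refine ⟨K * (CE + Cin * CE), by positivity, lam₁ / (2 * V₁ + 1), by positivity, fun ρ hρ hρ₁ => ?_⟩
  have hρlam : 2 * ρ * V₁ ≤ lam₁ := by
    rw [lt_div_iff₀ (by positivity)] at hρ₁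
    nlinarith
  -- the bound on a fixed torus of side `L ≥ max L₀ L₁` holding `n' + 2` particles, `n' ≥ 1`
  have key : ∀ (n' : ℕ) (L : ℝ), 1 ≤ n' → 0 < L → L₀ ≤ L → L₁ ≤ L →
      ((n' : ℝ) + 2) / L ^ 3 = ρ →
      ∀ Ψ : PeriodicTrialState (n' + 2) L, ContDiff ℝ 3 Ψ.ψ →
        periodicEnergy v Ψ = periodicGroundStateEnergy v (n' + 2) L → periodicEnergy v Ψ ≠ ⊤ →
        (∀ X, Ψ.ψ X = (‖Ψ.ψ X‖ : ℂ)) →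
        (∫⁻ X in cellN (n' + 2) L,
            periodicInteraction (Set.indicator (Set.Iic R₀) (fun _ : ℝ => (1 : ℝ≥0∞))) L X *
              (‖Ψ.ψ X‖₊ : ℝ≥0∞) ^ 2)
          ≤ ENNReal.ofReal K * (periodicEnergy v Ψ + ENNReal.ofReal Cin * periodicEnergy v Ψ) := by
    intro n' L hn' hLpos hL₀L hL₁L hL3 Ψ hC3 hmin hfinE hreal
    obtain ⟨n'', hn''⟩ : ∃ n'', n' = n'' + 1 := ⟨n' - 1, by omega⟩
    have hL3pos : 0 < L ^ 3 := by positivity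
    -- the removal energy is `≤ λ₁`
    have hE0fin : periodicGroundStateEnergy v n' L ≠ ⊤ := by
      rw [hn'']
      exact ne_top_of_le_ne_top ENNReal.ofReal_ne_top (hCE n'' L hLpos)
    have hrem : (periodicGroundStateEnergy v (n' + 2) L).toReal -
        (periodicGroundStateEnergy v n' L).toReal ≤ lam₁ := by
      have h := stub_removalEnergy v hv.1 n' L hLpos
      have hc : 0 ≤ (2 * (n' : ℝ) + 1) / L ^ 3 := by positivity
      have h' : (periodicGroundStateEnergy v (n' + 2) L).toReal ≤
          (periodicGroundStateEnergy v n' L).toReal + (2 * (n' : ℝ) + 1) / L ^ 3 * V₁ := by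
        have := ENNReal.toReal_mono (ENNReal.add_ne_top.2 ⟨hE0fin,
          ENNReal.mul_ne_top ENNReal.ofReal_ne_top hItop⟩) h
        rwa [ENNReal.toReal_add hE0fin (ENNReal.mul_ne_top ENNReal.ofReal_ne_top hItop),
          ENNReal.toReal_mul, ENNReal.toReal_ofReal hc] at this
      have hcoef : (2 * (n' : ℝ) + 1) / L ^ 3 ≤ 2 * ρ := by
        rw [← hL3, div_le_iff₀ hL3pos, mul_div_assoc', div_mul_cancel₀ _ hL3pos.ne']
        linarith
      have : (2 * (n' : ℝ) + 1) / L ^ 3 * V₁ ≤ 2 * ρ * V₁ := mul_le_mul_of_nonneg_right hcoef hV₁0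
      linarith
    -- inner and outer counts
    have hinner := hin n' L hL₁L Ψ hmin hfinE hC3 hreal hrem
    calc _ ≤ ENNReal.ofReal K * (periodicEnergy v Ψ +
            ∫⁻ X in cellN (n' + 2) L,
              periodicInteraction (Set.indicator (Set.Iic rin) (fun _ : ℝ => (1 : ℝ≥0∞))) L X *
                (‖Ψ.ψ X‖₊ : ℝ≥0∞) ^ 2) := hout (n' + 2) L hL₀L Ψ
      _ ≤ ENNReal.ofReal K * (periodicEnergy v Ψ + ENNReal.ofReal Cin * periodicEnergy v Ψ) := by
          gcongr
  filter_upwards [(tendsto_sideLength_succ hρ).eventually_ge_atTop (max L₀ L₁), eventually_ge_atTop 2]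
    with n hnL hn2 Ψ hC3 hmin hfinE hreal hne
  obtain ⟨n', rfl⟩ : ∃ n', n = n' + 1 := ⟨n - 1, by omega⟩
  have hLpos : 0 < sideLength ρ (n' + 1 + 1) := by
    unfold sideLength
    exact Real.rpow_pos_of_pos (by positivity) _
  have hL3 : ((n' : ℝ) + 2) / sideLength ρ (n' + 1 + 1) ^ 3 = ρ := by
    have h := div_sideLength_pow_three hρ (Nat.succ_pos (n' + 1))
    push_cast at h
    rw [show ((n' : ℝ) + 2) = (n' : ℝ) + 1 + 1 by ring]
    exact h
  have hkey := key n' (sideLength ρ (n' + 1 + 1)) (by omega) hLpos (le_trans (le_max_left _ _) hnL)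
    (le_trans (le_max_right _ _) hnL) hL3 Ψ hC3 hmin hfinE hreal
  -- the energy of the minimiser
  have hE : periodicEnergy v Ψ ≤ ENNReal.ofReal (CE * ρ * (((n' + 1 : ℕ) : ℝ) + 1)) := by
    rw [hmin, ← const_mul_sq_div_sideLength_cube hρ CE (n' + 1)]
    exact hCE (n' + 1) _ hLpos
  set X : ℝ := CE * ρ * (((n' + 1 : ℕ) : ℝ) + 1) with hX
  have hX0 : 0 ≤ X := by positivity
  calc _ ≤ ENNReal.ofReal K * (periodicEnergy v Ψ + ENNReal.ofReal Cin * periodicEnergy v Ψ) := hkey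
    _ ≤ ENNReal.ofReal K * (ENNReal.ofReal X + ENNReal.ofReal Cin * ENNReal.ofReal X) := by gcongr
    _ = ENNReal.ofReal (K * (CE + Cin * CE) * ρ * (((n' + 1 : ℕ) : ℝ) + 1)) := by
        rw [← ENNReal.ofReal_mul hCin, ← ENNReal.ofReal_add hX0 (by positivity), ← ENNReal.ofReal_mul hK]
        congr 1
        rw [hX]
        ring

/-- If `v` vanishes at every `r ≥ 0` then `ṽ(x) = v(|x|)` is the zero function, so the Puff weight profile
`W(r) = r²‖D²ṽ(r e₀)‖` vanishes identically. [folklore] -/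
theorem puffWeight_eq_zero_of_forall (v : ℝ → ℝ≥0∞) (h : ∀ r, 0 ≤ r → v r = 0) (r : ℝ) :
    ENNReal.ofReal (r ^ 2 * ‖iteratedFDeriv ℝ 2 (fun x : Space => (v ‖x‖).toReal)
      (r • EuclideanSpace.single (0 : Fin 3) (1 : ℝ))‖) = 0 := by
  have hzero : (fun x : Space => (v ‖x‖).toReal) = fun _ => (0 : ℝ) := by
    funext x
    rw [h _ (norm_nonneg x), ENNReal.toReal_zero]
  rw [hzero, iteratedFDeriv_fun_zero]
  simp

/-- **S7 `corelessPairMoment` (THEOREM modulo S7′).** For a smooth-class coreless `v` the Puff pair functional of the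
positive `C³` minimiser is `O(ρN)`: if `v` vanishes on `[0,∞)` the weight is identically zero; otherwise S7′ feeds c1's
landed reduction `stub_pairMomentOfPairCount`. -/
theorem corelessPairMoment :
    ∀ v : ℝ → ℝ≥0∞, IsRepulsiveFiniteRange v → (∀ r, v r ≠ ⊤) →
      ContDiff ℝ 2 (fun x : Space => (v ‖x‖).toReal) →
      (∃ Cₑ : ℝ, ∀ x : Space, ‖iteratedFDeriv ℝ 2 (fun x : Space => (v ‖x‖).toReal) x‖
          ≤ Cₑ * Real.sqrt ((v ‖x‖).toReal)) →
      v 0 = 0 →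
      ∃ C_P : ℝ, 0 ≤ C_P ∧ ∃ ρ₁ : ℝ, 0 < ρ₁ ∧ ∀ ρ : ℝ, 0 < ρ → ρ < ρ₁ → ∀ᶠ n : ℕ in atTop,
        ∀ Ψ : PeriodicTrialState (n + 1) (sideLength ρ (n + 1)), ContDiff ℝ 3 Ψ.ψ →
          periodicEnergy v Ψ = periodicGroundStateEnergy v (n + 1) (sideLength ρ (n + 1)) →
          periodicEnergy v Ψ ≠ ⊤ → (∀ X, Ψ.ψ X = (‖Ψ.ψ X‖ : ℂ)) → (∀ X, Ψ.ψ X ≠ 0) →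
          (∫⁻ X in cellN (n + 1) (sideLength ρ (n + 1)),
              periodicInteraction (fun r : ℝ => ENNReal.ofReal (r ^ 2 *
                ‖iteratedFDeriv ℝ 2 (fun x : Space => (v ‖x‖).toReal)
                  (r • EuclideanSpace.single (0 : Fin 3) (1 : ℝ))‖)) (sideLength ρ (n + 1)) X *
                (‖Ψ.ψ X‖₊ : ℝ≥0∞) ^ 2)
            ≤ ENNReal.ofReal (C_P * ρ * ((n : ℝ) + 1)) := by
  intro v hv hfin hC2 hedge h0
  by_cases hpos : ∃ r, 0 < r ∧ 0 < v r
  · obtain ⟨R₀, hR₀, hrange⟩ := exists_pos_range hv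
    exact stub_pairMomentOfPairCount v hv hfin hC2 hedge R₀ hrange
      (corelessPairCount v hv hfin hC2 hedge h0 hpos R₀ hR₀ hrange)
  · -- `v` vanishes on `[0, ∞)`: the weight is zero and so is the pair functional
    have hzero : ∀ r, 0 ≤ r → v r = 0 := by
      intro r hr
      rcases hr.eq_or_lt with rfl | hr'
      · exact h0
      · by_contra hne
        exact hpos ⟨r, hr', pos_iff_ne_zero.2 hne⟩
    refine ⟨0, le_rfl, 1, one_pos, fun ρ hρ hρ₁ => Filter.Eventually.of_forall fun n Ψ _ _ _ _ _ => ?_⟩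
    have hW : ∀ X : Config (n + 1),
        periodicInteraction (fun r : ℝ => ENNReal.ofReal (r ^ 2 *
          ‖iteratedFDeriv ℝ 2 (fun x : Space => (v ‖x‖).toReal)
            (r • EuclideanSpace.single (0 : Fin 3) (1 : ℝ))‖)) (sideLength ρ (n + 1)) X = 0 := by
      intro X
      unfold periodicInteraction periodizedPotential
      refine Finset.sum_eq_zero fun i _ => Finset.sum_eq_zero fun j _ => ?_
      exact ENNReal.tsum_eq_zero.2 fun q =>
        puffWeight_eq_zero_of_forall v hzero _
    simp [hW]

/-- **The coreless branch assembled**: for `v 0 = 0`, S7 + S3 + S4a + S4b + S5 + S6 give the crux's conclusion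
(lets inlined) with `C = c₁‖ṽ‖₁ + c₂C_P`. Kernel-checked glue (lead-0, unchanged). -/
theorem puffFloorCoreless_of_pairMoment
    (v : ℝ → ℝ≥0∞) (hv : IsRepulsiveFiniteRange v) (hfin : ∀ r, v r ≠ ⊤)
    (hC2 : ContDiff ℝ 2 (fun x : Space => (v ‖x‖).toReal))
    (hedge : ∃ Cₑ : ℝ, ∀ x : Space, ‖iteratedFDeriv ℝ 2 (fun x : Space => (v ‖x‖).toReal) x‖
        ≤ Cₑ * Real.sqrt ((v ‖x‖).toReal))
    (h0 : v 0 = 0) :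
    ∃ C : ℝ, 0 ≤ C ∧ ∃ ρ₀ : ℝ, 0 < ρ₀ ∧ ∀ ρ : ℝ, 0 < ρ → ρ < ρ₀ → ∀ᶠ n : ℕ in Filter.atTop,
        ∀ Ψ : PeriodicTrialState (n + 1) (sideLength ρ (n + 1)),
          periodicEnergy v Ψ = periodicGroundStateEnergy v (n + 1) (sideLength ρ (n + 1)) →
          periodicEnergy v Ψ ≠ ⊤ → (∀ X, Ψ.ψ X = (‖Ψ.ψ X‖ : ℂ)) → (∀ X, Ψ.ψ X ≠ 0) →
          ∀ m : Fin 3 → ℤ, m ≠ 0 →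
            ‖(2 * Real.pi / sideLength ρ (n + 1)) • latticeVec 1 m‖ /
                Real.sqrt (‖(2 * Real.pi / sideLength ρ (n + 1)) • latticeVec 1 m‖ ^ 2 + C * ρ) ≤
              ((n : ℝ) + 1)⁻¹ *
                ∫ X in cellN (n + 1) (sideLength ρ (n + 1)),
                  ‖∑ j : Fin (n + 1), cellWave (sideLength ρ (n + 1)) m (X j)‖ ^ 2 * ‖Ψ.ψ X‖ ^ 2 := by
  obtain ⟨R₀, hR₀, hrange⟩ := exists_pos_range hv
  obtain ⟨CE, hCE0, hCE⟩ := bornEnergyBound v hv hfin hC2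
  obtain ⟨c₁, c₂, hc₁, hc₂, hPuff⟩ := stub_puffFeynmanFloor
  obtain ⟨CP, hCP0, ρ₁, hρ₁, hP⟩ := corelessPairMoment v hv hfin hC2 hedge h0
  refine ⟨c₁ * CE + c₂ * CP, by positivity, ρ₁, hρ₁, fun ρ hρ hρ₁' => ?_⟩
  filter_upwards [hP ρ hρ hρ₁',
    (tendsto_sideLength_succ hρ).eventually_gt_atTop (2 * R₀)] with n hn h2R₀ Ψ hmin hfinE hreal hne m hm
  have hLpos : 0 < sideLength ρ (n + 1) := by
    unfold sideLength
    exact Real.rpow_pos_of_pos (by positivity) _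
  obtain ⟨Ψ₀, hmin₀, _hfin₀, hC3₀, hreal₀, hne₀⟩ :=
    Theorems.stub_positiveMinimiser v hv hfin hC2 hedge n (sideLength ρ (n + 1)) hLpos
  have hΨ : Ψ = Ψ₀ :=
    Theorems.stub_positiveMinimiserUnique v hv.1 n (sideLength ρ (n + 1)) hLpos Ψ Ψ₀ hmin hfinE hreal hne
      hmin₀ hreal₀ hne₀
  have hC3 : ContDiff ℝ 3 Ψ.ψ := by rw [hΨ]; exact hC3₀
  have hEL := Theorems.stub_eulerLagrange v hv hfin hC2 R₀ hR₀ hrange n (sideLength ρ (n + 1)) hLpos h2R₀ Ψ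
    hC3 hmin hfinE
  have hPint := hn Ψ hC3 hmin hfinE hreal hne
  have hE : periodicEnergy v Ψ ≤ ENNReal.ofReal (CE * ρ * ((n : ℝ) + 1)) := by
    rw [hmin, ← const_mul_sq_div_sideLength_cube hρ CE n]
    exact hCE n (sideLength ρ (n + 1)) hLpos
  have hT : (∫⁻ X in cellN (n + 1) (sideLength ρ (n + 1)), kineticDensity Ψ.ψ X)
      ≤ ENNReal.ofReal (CE * ρ * ((n : ℝ) + 1)) :=
    le_trans (lintegral_mono fun X => le_self_add) hE
  have key := weighted_add_le (by positivity) (by positivity) hc₁ hc₂ hT hPint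
  have hring : c₁ * (CE * ρ * ((n : ℝ) + 1)) + c₂ * (CP * ρ * ((n : ℝ) + 1)) =
      (c₁ * CE + c₂ * CP) * ρ * ((n : ℝ) + 1) := by ring
  rw [hring] at key
  exact hPuff v hv hfin hC2 R₀ hR₀ hrange n (sideLength ρ (n + 1)) hLpos h2R₀ Ψ hC3 hmin hfinE hreal hne
    hEL ((c₁ * CE + c₂ * CP) * ρ) (by positivity) key m hm

end PuffFloorAssembly

open PuffFloorAssembly in
/-- **`PuffFloor` (crux stmt-AtomisticToContinuum-11785 of route `BECConjugateDomination`), from the line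
`coupling-slope-pocket`**: case split on the core. Solid core `0 < v 0`: `stub_puffFloorSolidCore` (Lee's lever,
Puff–Feynman engine). Coreless `v 0 = 0`: `puffFloorCoreless_of_pairMoment` (pair-count mechanism). The crux's `let`s
are definitionally the inlined forms. Sources: Puff1965; Stringari1995 §2.3; Lee2009 Thm 7; LSSY2005 Ch. 2. -/
theorem PuffFloor_proof : PuffFloor := by
  intro v hv hfin hC2 hedge
  by_cases hcore : 0 < v 0
  · exact stub_puffFloorSolidCore v hv hfin hC2 hedge hcore
  · have h0 : v 0 = 0 := le_antisymm (not_lt.1 hcore) bot_le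
    exact puffFloorCoreless_of_pairMoment v hv hfin hC2 hedge h0


end Summit.AtomisticToContinuum.BoseEinsteinCondensation.Theorems

end
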